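import Mathlib
import HarnessLib
import Literature.Probability.Process.RootedHardCoreVague
import Summits.AtomisticToContinuum.Crystallization.Theorems.PalmUnimodularRigidityBenjaminiSchrammLimitCampbell

/-!
# Ergodic reduction for the crux `AperiodicFrustratedLawGap` — conditional laws given a sub-σ-algebra

Route `FrustratedLawDichotomy`, crux `AperiodicFrustratedLawGap` (item `stmt-AtomisticToContinuum-27623`),
registered stub `stub_ergodicReduction` (skeleton `dd3251ad731e`); companion of
`FrustratedLawDichotomyAperiodicFrustratedLawGapErgodic{Reduction,Pullback,Campbell,Restrict,Sigma}`.
Step D3 of the ergodic-decomposition plan recorded in `…ErgodicReduction`, generic part: the regular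
conditional laws `condExpKernel Q m` of a finite measure `Q` on a standard Borel space given a
sub-σ-algebra `m` (Mathlib) DISINTEGRATE `Q` over every `m`-event, and two `m`-measurable functions with
the same integrals over all `m`-events agree almost everywhere.  These are the two facts through which
"every restriction `Q|_A`, `A ∈ 𝓘`, is Campbell-invariant" (`…ErgodicRestrict`) becomes "almost every
conditional law is Campbell-invariant" (step D3 proper, on a countable generating π-system).

* `setLIntegral_condExpKernel` — `∫⁻_{A} κ_ω(D) dQ = Q (D ∩ A)` for `A ∈ m`, `D` measurable;
* `restrict_eq_bind_condExpKernel` — `Q|_A = (Q|_A).bind κ` for `A ∈ m`;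
* `setLIntegral_lintegral_condExpKernel` — `∫⁻_{A} (∫⁻ g dκ_ω) dQ = ∫⁻_{A} g dQ`;
* `ae_eq_of_forall_setLIntegral_eq_of_measurable_sub` — `m`-measurable `φ, ψ` with equal integrals over
  all `m`-events are `Q`-a.e. equal (through the trimmed measure);
* `exists_window_piSystem` — a countable generating π-system of (configurations) × `ℝ³` containing the
  windows `univ × B(0, n+1)`;
* `ae_map_reroot_compProd_condExpKernel` — **step D3 proper**: if every restriction `Q|_A`, `A ∈ m`, has
  a Campbell measure invariant under the re-rooting involution, then so has `condExpKernel Q m ω` for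
  `Q`-almost every `ω`.

`[folklore]` (disintegration / regular conditional probabilities; Kallenberg FMP3 Thm 8.5).
-/

noncomputable section

namespace Summit.AtomisticToContinuum.Crystallization.Theorems.FrustratedLawDichotomyErgodicReduction

open MeasureTheory Set Filter ProbabilityTheory
open scoped ENNReal

section Generic

variable {Ω : Type*} {m : MeasurableSpace Ω} [mΩ : MeasurableSpace Ω] [StandardBorelSpace Ω]
  {Q : Measure Ω} [IsFiniteMeasure Q]

/-- **Conditional laws disintegrate over the conditioning events**: for `A ∈ m` and measurable `D`,
`∫⁻_{A} condExpKernel Q m ω (D) dQ(ω) = Q (D ∩ A)` (the defining property of the conditional expectation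
`Q⟦D | m⟧`, of which `ω ↦ κ_ω(D)` is a version). [folklore] -/
theorem setLIntegral_condExpKernel (hm : m ≤ mΩ) {A : Set Ω} (hA : MeasurableSet[m] A) {D : Set Ω}
    (hD : MeasurableSet D) :
    ∫⁻ ω in A, condExpKernel Q m ω D ∂Q = Q (D ∩ A) := by
  haveI : SigmaFinite (Q.trim hm) := by
    haveI : IsFiniteMeasure (Q.trim hm) := isFiniteMeasure_trim hm
    infer_instance
  have hint : Integrable (fun ω => (condExpKernel Q m ω).real D) Q := integrable_toReal_condExpKernel hD
  have hae : (fun ω => (condExpKernel Q m ω).real D) =ᵐ[Q] Q⟦D|m⟧ := condExpKernel_ae_eq_condExp hm hD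
  -- through the Bochner integral of the real version
  have h1 : ∫⁻ ω in A, condExpKernel Q m ω D ∂Q =
      ENNReal.ofReal (∫ ω in A, (condExpKernel Q m ω).real D ∂Q) := by
    rw [ofReal_integral_eq_lintegral_ofReal hint.integrableOn
      (Eventually.of_forall fun ω => measureReal_nonneg)]
    refine lintegral_congr fun ω => ?_
    rw [ofReal_measureReal]
  have h2 : ∫ ω in A, (condExpKernel Q m ω).real D ∂Q = ∫ ω in A, (Q⟦D|m⟧) ω ∂Q :=
    setIntegral_congr_ae (hm A hA) (hae.mono fun ω hω _ => hω)
  have h3 : ∫ ω in A, (Q⟦D|m⟧) ω ∂Q = ∫ ω in A, D.indicator (fun _ => (1 : ℝ)) ω ∂Q :=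
    setIntegral_condExp hm ((integrable_const (1 : ℝ)).indicator hD) hA
  have h4 : ∫ ω in A, D.indicator (fun _ => (1 : ℝ)) ω ∂Q = Q.real (D ∩ A) := by
    rw [integral_indicator hD, Measure.restrict_restrict hD, setIntegral_const, smul_eq_mul, mul_one]
  rw [h1, h2, h3, h4, ofReal_measureReal]

/-- **The restriction of `Q` to an `m`-event is the `Q|_A`-mixture of the conditional laws**:
`Q|_A = (Q|_A).bind (condExpKernel Q m)` for `A ∈ m`. [folklore] -/
theorem restrict_eq_bind_condExpKernel (hm : m ≤ mΩ) {A : Set Ω} (hA : MeasurableSet[m] A) :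
    Q.restrict A = (Q.restrict A).bind (condExpKernel Q m) := by
  have hκ : Measurable (condExpKernel Q m : Ω → Measure Ω) :=
    (condExpKernel Q m).measurable.mono hm le_rfl
  refine Measure.ext fun D hD => ?_
  rw [Measure.bind_apply hD hκ.aemeasurable, setLIntegral_condExpKernel hm hA hD,
    Measure.restrict_apply hD]

/-- **Integrating a conditional integral over an `m`-event**: `∫⁻_{A} (∫⁻ g dκ_ω) dQ(ω) = ∫⁻_{A} g dQ`
for `A ∈ m` and measurable `g ≥ 0`. [folklore] -/
theorem setLIntegral_lintegral_condExpKernel (hm : m ≤ mΩ) {A : Set Ω} (hA : MeasurableSet[m] A)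
    {g : Ω → ℝ≥0∞} (hg : Measurable g) :
    ∫⁻ ω in A, ∫⁻ x, g x ∂(condExpKernel Q m ω) ∂Q = ∫⁻ x in A, g x ∂Q := by
  have hκ : Measurable (condExpKernel Q m : Ω → Measure Ω) :=
    (condExpKernel Q m).measurable.mono hm le_rfl
  conv_rhs => rw [restrict_eq_bind_condExpKernel hm hA]
  rw [Measure.lintegral_bind hκ.aemeasurable hg.aemeasurable]

omit [StandardBorelSpace Ω] in
/-- **`m`-measurable functions with equal integrals over all `m`-events agree almost everywhere**
(through the trimmed measure `Q.trim hm`, which is finite hence σ-finite). [folklore] -/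
theorem ae_eq_of_forall_setLIntegral_eq_of_measurable_sub (hm : m ≤ mΩ) {φ ψ : Ω → ℝ≥0∞}
    (hφ : Measurable[m] φ) (hψ : Measurable[m] ψ)
    (h : ∀ A : Set Ω, MeasurableSet[m] A → ∫⁻ ω in A, φ ω ∂Q = ∫⁻ ω in A, ψ ω ∂Q) :
    φ =ᵐ[Q] ψ := by
  haveI : SigmaFinite (Q.trim hm) := by
    haveI : IsFiniteMeasure (Q.trim hm) := isFiniteMeasure_trim hm
    infer_instance
  refine ae_eq_of_ae_eq_trim (hm := hm) ?_
  refine ae_eq_of_forall_setLIntegral_eq_of_sigmaFinite hφ hψ fun A hA _ => ?_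
  rw [restrict_trim hm Q hA, lintegral_trim hm hφ, lintegral_trim hm hψ]
  exact h A hA

end Generic


section Configurations

open Literature.Probability.Process (LocalConfig)
open Literature.Probability.Process.LocalConfig (RootedHardCoreConfig toMeasure_def measurable_toMeasure)
open Summit.AtomisticToContinuum.Crystallization.Theorems.BenjaminiSchrammLimit (isSFiniteKernel_toMeasure
  measurable_reroot compProd_univ_prod_closedBall_lt_top)
open TopologicalSpace
open scoped Classical

variable {δ : ℝ}

/-- **A countable generating π-system with windows.**  On (rooted `δ`-hard-core configurations of
`ℝ³`) × `ℝ³` there is a countable family of open sets — a countable basis of the topology together with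
the windows `univ × B(0, n+1)` — whose finite intersections form a π-system generating the Borel (=
product) σ-algebra. [folklore] -/
theorem exists_window_piSystem [Fact (0 < δ)] :
    ∃ g : ℕ ⊕ ℕ → Set (RootedHardCoreConfig (EuclideanSpace ℝ (Fin 3)) δ × EuclideanSpace ℝ (Fin 3)),
      (∀ i, IsOpen (g i)) ∧
      (∀ n : ℕ, g (Sum.inr n) = univ ×ˢ Metric.ball (0 : EuclideanSpace ℝ (Fin 3)) (n + 1)) ∧
      (inferInstance : MeasurableSpace
          (RootedHardCoreConfig (EuclideanSpace ℝ (Fin 3)) δ × EuclideanSpace ℝ (Fin 3))) =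
        MeasurableSpace.generateFrom (Set.range fun F : Finset (ℕ ⊕ ℕ) => ⋂ i ∈ F, g i) ∧
      IsPiSystem (Set.range fun F : Finset (ℕ ⊕ ℕ) => ⋂ i ∈ F, g i) := by
  have hB := isBasis_countableBasis
    (RootedHardCoreConfig (EuclideanSpace ℝ (Fin 3)) δ × EuclideanSpace ℝ (Fin 3))
  have hne : (countableBasis
      (RootedHardCoreConfig (EuclideanSpace ℝ (Fin 3)) δ × EuclideanSpace ℝ (Fin 3))).Nonempty := by
    have p : RootedHardCoreConfig (EuclideanSpace ℝ (Fin 3)) δ × EuclideanSpace ℝ (Fin 3) :=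
      (⟨LocalConfig.mk {0}, Set.mem_singleton _, fun x hx y hy hxy =>
        (hxy ((show x = 0 from hx).trans (show y = 0 from hy).symm)).elim⟩, 0)
    obtain ⟨u, hu, -, -⟩ := hB.exists_subset_of_mem_open (mem_univ p) isOpen_univ
    exact ⟨u, hu⟩
  obtain ⟨b, hb⟩ := (countable_countableBasis
    (RootedHardCoreConfig (EuclideanSpace ℝ (Fin 3)) δ × EuclideanSpace ℝ (Fin 3))).exists_eq_range hne
  set g : ℕ ⊕ ℕ → Set (RootedHardCoreConfig (EuclideanSpace ℝ (Fin 3)) δ × EuclideanSpace ℝ (Fin 3)) :=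
    fun i => Sum.elim b (fun n : ℕ => univ ×ˢ Metric.ball (0 : EuclideanSpace ℝ (Fin 3)) (n + 1)) i
    with hg_def
  have hgo : ∀ i, IsOpen (g i) := by
    rintro (k | n)
    · exact hB.isOpen (hb ▸ mem_range_self k)
    · exact isOpen_univ.prod Metric.isOpen_ball
  refine ⟨g, hgo, fun n => rfl, ?_, ?_⟩
  · refine le_antisymm ?_ (MeasurableSpace.generateFrom_le ?_)
    · rw [BorelSpace.measurable_eq
        (α := RootedHardCoreConfig (EuclideanSpace ℝ (Fin 3)) δ × EuclideanSpace ℝ (Fin 3)),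
        hB.borel_eq_generateFrom]
      refine MeasurableSpace.generateFrom_le fun u hu => ?_
      rw [hb] at hu
      obtain ⟨k, rfl⟩ := hu
      exact MeasurableSpace.measurableSet_generateFrom ⟨{Sum.inl k}, by simp [hg_def]⟩
    · rintro _ ⟨F, rfl⟩
      exact (isOpen_biInter_finset fun i _ => hgo i).measurableSet
  · rintro _ ⟨F₁, rfl⟩ _ ⟨F₂, rfl⟩ -
    refine ⟨F₁ ∪ F₂, ?_⟩
    ext p
    simp only [mem_iInter, Finset.mem_union, mem_inter_iff]
    exact ⟨fun h => ⟨fun i hi => h i (Or.inl hi), fun i hi => h i (Or.inr hi)⟩,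
      fun h i hi => hi.elim (h.1 i) (h.2 i)⟩

end Configurations

section GenericInvariance

variable {Ω β : Type*} {m : MeasurableSpace Ω} [mΩ : MeasurableSpace Ω] [StandardBorelSpace Ω]
  [MeasurableSpace β] {Q : Measure Ω} [IsProbabilityMeasure Q]

/-- **Almost every conditional law inherits an invariance of all restrictions (step D3, generic form).**
Let `Q` be a probability measure on a standard Borel space, `m` a sub-σ-algebra, `η` an s-finite kernel
(think: the counting kernel `κ₀ S = count|S`) and `T` a measurable self-map of `Ω × β` (think: the
re-rooting involution `Θ`).  Suppose the "Campbell measure" `(Q|_A) ⊗ₘ η` of the restriction of `Q` to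
EVERY `m`-event `A` is `T`-invariant.  Then for `Q`-almost every `ω` the Campbell measure of the
conditional law `condExpKernel Q m ω` is `T`-invariant — provided the product σ-algebra has a countable
generating π-system `range c` containing a spanning sequence `B` on which Campbell measures of probability
laws are finite (`exists_window_piSystem` for configurations).  Proof: for each `C = c i`, the functions
`ω ↦ (κ_ω ⊗ₘ η)(T⁻¹ C)` and `ω ↦ (κ_ω ⊗ₘ η)(C)` are `m`-measurable with equal integrals over every `m`-event
(`setLIntegral_lintegral_condExpKernel` and the hypothesis), hence a.e. equal
(`ae_eq_of_forall_setLIntegral_eq_of_measurable_sub`); countably many `C` at once; then uniqueness of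
measures on a generating π-system. [folklore] -/
theorem ae_map_compProd_condExpKernel_eq (hm : m ≤ mΩ) {η : Kernel Ω β} [IsSFiniteKernel η]
    {T : Ω × β → Ω × β} (hT : Measurable T)
    (hres : ∀ A : Set Ω, MeasurableSet[m] A → ((Q.restrict A) ⊗ₘ η).map T = (Q.restrict A) ⊗ₘ η)
    {ι : Type*} [Countable ι] {c : ι → Set (Ω × β)} (hc : ∀ i, MeasurableSet (c i))
    (hgen : (inferInstance : MeasurableSpace (Ω × β)) = MeasurableSpace.generateFrom (Set.range c))
    (hpi : IsPiSystem (Set.range c)) {B : ℕ → Set (Ω × β)} (hBU : ⋃ n, B n = univ)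
    (hBc : ∀ n, B n ∈ Set.range c)
    (hfin : ∀ (ν : Measure Ω) [IsProbabilityMeasure ν] (n : ℕ), (ν ⊗ₘ η) (B n) ≠ ∞) :
    ∀ᵐ ω ∂Q, ((condExpKernel Q m ω) ⊗ₘ η).map T = (condExpKernel Q m ω) ⊗ₘ η := by
  -- `ω ↦ (κ_ω ⊗ η)(C)` is `m`-measurable and integrates over `A ∈ m` to `((Q|_A) ⊗ η)(C)`
  have hφ : ∀ C : Set (Ω × β), MeasurableSet C →
      Measurable[m] (fun ω => ((condExpKernel Q m ω) ⊗ₘ η) C) ∧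
      ∀ A : Set Ω, MeasurableSet[m] A →
        ∫⁻ ω in A, ((condExpKernel Q m ω) ⊗ₘ η) C ∂Q = ((Q.restrict A) ⊗ₘ η) C := by
    intro C hC
    have hgC : Measurable fun x : Ω => η x (Prod.mk x ⁻¹' C) := Kernel.measurable_kernel_prodMk_left hC
    simp_rw [Measure.compProd_apply hC]
    exact ⟨hgC.lintegral_kernel, fun A hA => setLIntegral_lintegral_condExpKernel hm hA hgC⟩
  -- hence for every measurable `C`: `(κ_ω ⊗ η)(T⁻¹ C) = (κ_ω ⊗ η)(C)` for a.e. `ω`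
  have hae : ∀ C : Set (Ω × β), MeasurableSet C → ∀ᵐ ω ∂Q,
      ((condExpKernel Q m ω) ⊗ₘ η) (T ⁻¹' C) = ((condExpKernel Q m ω) ⊗ₘ η) C := by
    intro C hC
    obtain ⟨hφ1, hφ2⟩ := hφ _ (hT hC)
    obtain ⟨hψ1, hψ2⟩ := hφ C hC
    refine ae_eq_of_forall_setLIntegral_eq_of_measurable_sub hm hφ1 hψ1 fun A hA => ?_
    rw [hφ2 A hA, hψ2 A hA, ← Measure.map_apply hT hC, hres A hA]
  -- all sets of the countable π-system at once
  have hall : ∀ᵐ ω ∂Q, ∀ i : ι,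
      ((condExpKernel Q m ω) ⊗ₘ η) (T ⁻¹' c i) = ((condExpKernel Q m ω) ⊗ₘ η) (c i) := by
    rw [ae_all_iff]
    exact fun i => hae _ (hc i)
  filter_upwards [hall] with ω hω
  refine (Measure.ext_of_generateFrom_of_iUnion (Set.range c) B hgen hpi hBU hBc
    (fun n => hfin _ n) ?_).symm
  rintro _ ⟨i, rfl⟩
  rw [Measure.map_apply hT (hc i)]
  exact (hω i).symm

end GenericInvariance

section ConfigurationsInvariance

open Literature.Probability.Process (LocalConfig)
open Literature.Probability.Process.LocalConfig (RootedHardCoreConfig toMeasure_def measurable_toMeasure)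
open Summit.AtomisticToContinuum.Crystallization.Theorems.BenjaminiSchrammLimit (isSFiniteKernel_toMeasure
  measurable_reroot compProd_univ_prod_closedBall_lt_top)
open TopologicalSpace
open scoped Classical

variable {δ : ℝ}

/-- **Almost every conditional law is Campbell-invariant (step D3, configurations).**  Let `Q` be a
probability law on rooted `δ`-hard-core configurations of `ℝ³` (`δ > 0`) and `𝓘` a sub-σ-algebra of the
Borel σ-algebra (packaged as a subtype `𝓘 = ⟨m, hm⟩` of the σ-algebras below the instance
`Subtype.instMeasurableSpace`, so that `m` is not picked up as an instance) such that the restriction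
of `Q` to EVERY `𝓘`-event has a Campbell measure invariant under the re-rooting involution `Θ` (for the
re-rooting-invariant σ-algebra: `…ErgodicRestrict.map_reroot_compProd_restrict`).  Then `Q`-almost every
conditional law `condExpKernel Q 𝓘 ω` has a `Θ`-invariant Campbell measure (so, by
`BenjaminiSchrammLimit.isPointStationaryLaw_map_toMeasure`, its push-forward along `S ↦ count|S` is
point-stationary). [folklore] -/
theorem ae_map_reroot_compProd_condExpKernel [Fact (0 < δ)]
    {Q : Measure (RootedHardCoreConfig (EuclideanSpace ℝ (Fin 3)) δ)} [IsProbabilityMeasure Q]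
    (𝓘 : {m : MeasurableSpace (RootedHardCoreConfig (EuclideanSpace ℝ (Fin 3)) δ) //
      m ≤ (Subtype.instMeasurableSpace : MeasurableSpace (RootedHardCoreConfig (EuclideanSpace ℝ (Fin 3)) δ))})
    (hres : ∀ A : Set (RootedHardCoreConfig (EuclideanSpace ℝ (Fin 3)) δ), MeasurableSet[𝓘.1] A →
      haveI := isSFiniteKernel_toMeasure (E := EuclideanSpace ℝ (Fin 3)) (δ := δ)
      ((Q.restrict A) ⊗ₘ (⟨fun S : RootedHardCoreConfig (EuclideanSpace ℝ (Fin 3)) δ =>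
          (S.1 : LocalConfig (EuclideanSpace ℝ (Fin 3))).toMeasure,
          measurable_toMeasure (Fact.out : 0 < δ)⟩ :
          Kernel (RootedHardCoreConfig (EuclideanSpace ℝ (Fin 3)) δ) (EuclideanSpace ℝ (Fin 3)))).map
        (fun p : RootedHardCoreConfig (EuclideanSpace ℝ (Fin 3)) δ × EuclideanSpace ℝ (Fin 3) =>
          ((if h : p.2 ∈ ((p.1.1 : LocalConfig (EuclideanSpace ℝ (Fin 3))) : Set (EuclideanSpace ℝ (Fin 3)))
            then p.1.reroot p.2 h else p.1 : RootedHardCoreConfig (EuclideanSpace ℝ (Fin 3)) δ), -p.2)) =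
      (Q.restrict A) ⊗ₘ (⟨fun S : RootedHardCoreConfig (EuclideanSpace ℝ (Fin 3)) δ =>
          (S.1 : LocalConfig (EuclideanSpace ℝ (Fin 3))).toMeasure,
          measurable_toMeasure (Fact.out : 0 < δ)⟩ :
          Kernel (RootedHardCoreConfig (EuclideanSpace ℝ (Fin 3)) δ) (EuclideanSpace ℝ (Fin 3)))) :
    ∀ᵐ ω ∂Q, haveI := isSFiniteKernel_toMeasure (E := EuclideanSpace ℝ (Fin 3)) (δ := δ)
      ((condExpKernel Q 𝓘.1 ω) ⊗ₘ (⟨fun S : RootedHardCoreConfig (EuclideanSpace ℝ (Fin 3)) δ =>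
          (S.1 : LocalConfig (EuclideanSpace ℝ (Fin 3))).toMeasure,
          measurable_toMeasure (Fact.out : 0 < δ)⟩ :
          Kernel (RootedHardCoreConfig (EuclideanSpace ℝ (Fin 3)) δ) (EuclideanSpace ℝ (Fin 3)))).map
        (fun p : RootedHardCoreConfig (EuclideanSpace ℝ (Fin 3)) δ × EuclideanSpace ℝ (Fin 3) =>
          ((if h : p.2 ∈ ((p.1.1 : LocalConfig (EuclideanSpace ℝ (Fin 3))) : Set (EuclideanSpace ℝ (Fin 3)))
            then p.1.reroot p.2 h else p.1 : RootedHardCoreConfig (EuclideanSpace ℝ (Fin 3)) δ), -p.2)) =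
      (condExpKernel Q 𝓘.1 ω) ⊗ₘ (⟨fun S : RootedHardCoreConfig (EuclideanSpace ℝ (Fin 3)) δ =>
          (S.1 : LocalConfig (EuclideanSpace ℝ (Fin 3))).toMeasure,
          measurable_toMeasure (Fact.out : 0 < δ)⟩ :
          Kernel (RootedHardCoreConfig (EuclideanSpace ℝ (Fin 3)) δ) (EuclideanSpace ℝ (Fin 3))) := by
  haveI := isSFiniteKernel_toMeasure (E := EuclideanSpace ℝ (Fin 3)) (δ := δ)
  have hδ : 0 < δ := Fact.out
  have hΘ : Measurable (fun p : RootedHardCoreConfig (EuclideanSpace ℝ (Fin 3)) δ × EuclideanSpace ℝ (Fin 3) =>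
      ((if h : p.2 ∈ ((p.1.1 : LocalConfig (EuclideanSpace ℝ (Fin 3))) : Set (EuclideanSpace ℝ (Fin 3)))
        then p.1.reroot p.2 h else p.1 : RootedHardCoreConfig (EuclideanSpace ℝ (Fin 3)) δ), -p.2)) :=
    measurable_reroot hδ
  obtain ⟨g, hgo, hgw, hgen, hpi⟩ := exists_window_piSystem (δ := δ)
  refine ae_map_compProd_condExpKernel_eq (m := 𝓘.1) 𝓘.2 hΘ hres
    (c := fun F : Finset (ℕ ⊕ ℕ) => ⋂ i ∈ F, g i)
    (fun F => Finset.measurableSet_biInter F fun i _ => (hgo i).measurableSet) hgen hpi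
    (B := fun n : ℕ => univ ×ˢ Metric.ball (0 : EuclideanSpace ℝ (Fin 3)) (n + 1)) ?_ ?_ ?_
  · ext p
    simp only [mem_iUnion, mem_prod, mem_univ, true_and, Metric.mem_ball, dist_zero_right, iff_true]
    obtain ⟨n, hn⟩ := exists_nat_gt ‖p.2‖
    exact ⟨n, hn.trans (lt_add_one _)⟩
  · intro n
    exact ⟨{Sum.inr n}, by simp [hgw n]⟩
  · intro ν hν n
    exact ((measure_mono (Set.prod_mono le_rfl Metric.ball_subset_closedBall)).trans_lt
      (compProd_univ_prod_closedBall_lt_top ν ((n : ℝ) + 1))).ne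

end ConfigurationsInvariance


end Summit.AtomisticToContinuum.Crystallization.Theorems.FrustratedLawDichotomyErgodicReduction

end
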